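import Summits.CriticalPhenomena.CardyFormulaZ2.Theorems.CardySusyWardParafermionFamiliesToSLESixFreePhase
import Summits.CriticalPhenomena.CardyFormulaZ2.Theorems.CardySusyWardParafermionFamiliesToSLESixWiredTouch

/-!
# The concrete anchor family (skeleton r4 of line `strip-anchored-vertex-normalisation`,
# crux stmt-CriticalPhenomena-10814), VI: the ABSOLUTE phases of the lower-right WIRED swing corners

Registered sub-goal `stub_anchorWiredPhaseLR` of the stub `stub_anchorMoment_of_IP`. For the concrete anchor
data `E = anchorData δ` at level `L` (`L δ < 2 ≤ (L + 1) δ`; `s = v₀ + v₁`, `d = v₀ - v₁`; the sites with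
`d ∈ {L - 1, L}` form the lower-right side of the wired arc `A`, `…AnchorDataLattice.lean`), every boundary
face `F` of that side (`d(F) = L - 1`, `|s(F)| ≤ L - 5`; corners `F`, `F + e₀`, `F + e₀ + e₁` on `A`, `F + e₁`
inside) is swung around CLOCKWISE by the exploration whenever it is visited: the entering dart
`(F + e₀ + e₁, 2)` (from the layer edge `s(F + e₁, F + e₀ + e₁)` to the frozen-open `A`–`A` edge
`s(F + e₀ + e₁, F + e₀)`), the dart `(F + e₀, 1)` between the two frozen-open sides of `F`, and the leaving
dart `(F, 0)` (back to the layer edge `s(F, F + e₁)`) come together, with turn counts `t, t - 1, t - 2`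
(`swing_fwd`, `swing_bwd`). The two corner observables at `F` are therefore
`G(F + e₀ + e₁, F) = sixthPhase 0 · P(swing at F)` and `G(F, F) = sixthPhase (-2) · P(swing at F)`:

* `AnchorWired.memA_of / openA_of / openA_tgt / closed_empty_tgt` — the wired arc in coordinates, the
  frozen-open `A`–`A` edges (open in every completed configuration), and the layer edges, closed in the
  completed ALL-CLOSED configuration `E.bcBondConfig ∅` (generic for the three wired sides);
* `orbit_four`, `shift_empty`, `visit_all` — ABSOLUTE anchoring: the all-closed exploration hugs the wired
  arc; from the start corner `((L-1,1), 2)` it reaches `((L-2,-1), 0)` in four steps (follow, cross, follow,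
  follow: turn count `-2`) and then moves one face down the side every four steps (cross, cross, follow,
  follow: same turn count), so it visits every `(F, 0)` of the side with turn count `-2`;
* the wired TouchPhase `WiredTouch.turnCount_visit_const` (`…WiredTouch.lean`: visits of darts with vertex
  on `A` persist when edges are closed, `S5.turnCount_eq_of_agree_off`) transfers `-2` to every visit of
  `(F, 0)` in every configuration, hence `0` to every visit of the entering dart; `WiredTouch.cornerObs_eq_of_visit_iff`
  evaluates both corners on the common event `{(F, 0) is visited}`.
-/

noncomputable section

namespace Summit.CriticalPhenomena.CardyFormulaZ2.Theorems.ParafermionFamiliesToSLESix.StripAnchored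

open MeasureTheory Filter Set Metric
open scoped Topology BigOperators
open Literature.Probability.LatticeModels
open Literature.Probability.Percolation (bondPercolation half BondConfig)
open Literature.Probability.RandomPlanarGeometry (DobrushinDomain)
open Summit.CriticalPhenomena.CardyFormulaZ2.Theorems.ParafermionPrecompact.Negative (IsFamily VanishesOn)
open Summit.CriticalPhenomena.CardyFormulaZ2.Cruxes.EdgePrecompact.QkzStripBoundaryArm (cornerObs)
open Literature.Probability.LatticeModels.DiscreteDobrushin (startCorner exitTime isStartCorner_startCorner
  isInnerFace_of_lt_exitTime not_isInnerFace_exitTime)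
open S5 (anchorDomain)
open S2 (sixthPhase)

/-! ## The wired arc of the anchor data in coordinates (generic for the three wired sides) -/

namespace AnchorWired

variable {δ : ℝ} {L : ℤ}

section Level

variable (hδ : 0 < δ) (hLδ : (L : ℝ) * δ < 2) (hL1 : 2 ≤ ((L : ℝ) + 1) * δ) (hL : 4 ≤ L)
include hδ hLδ hL1 hL

/-- **Sites of the wired arc, linearly**: a site of the diamond with `d ≥ L - 1` (lower-right side),
`d ≤ -(L - 1)` (upper-left side), `s ≤ -(L - 1)` (lower-left side), or of level `≥ L - 1` with `|d| > L - 3`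
(the two ends of the free side) is on the arc `A`. [folklore] -/
theorem memA_of {v : Site 2}
    (h : (v 0 + v 1 ≤ L ∧ -L ≤ v 0 + v 1 ∧ v 0 - v 1 ≤ L ∧ -L ≤ v 0 - v 1) ∧
      (L - 1 ≤ v 0 - v 1 ∨ v 0 - v 1 ≤ -(L - 1) ∨ v 0 + v 1 ≤ -(L - 1) ∨
        (L - 1 ≤ v 0 + v 1 ∧ (L - 3 < v 0 - v 1 ∨ v 0 - v 1 < -(L - 3))))) :
    v ∈ (anchorData δ).zdArcA := by
  rw [AnchorLattice.mem_zdArcA_iff hδ hLδ hL1 hL,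
    S5.mem_zdBoundary_anchor_iff (E := anchorData δ) rfl rfl hδ (by omega) hLδ hL1]
  simp only [abs_le, le_abs']
  omega

/-- **The frozen-open edges**: a lattice edge between two sites of the wired arc (in the linear form of
`memA_of`) is open in EVERY completed configuration. [cite: Smirnov2001, §2] -/
theorem openA_of {x y : Site 2} (hxy : (zdGraph 2).Adj x y) (ω : BondConfig (Site 2))
    (hx : (x 0 + x 1 ≤ L ∧ -L ≤ x 0 + x 1 ∧ x 0 - x 1 ≤ L ∧ -L ≤ x 0 - x 1) ∧
      (L - 1 ≤ x 0 - x 1 ∨ x 0 - x 1 ≤ -(L - 1) ∨ x 0 + x 1 ≤ -(L - 1) ∨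
        (L - 1 ≤ x 0 + x 1 ∧ (L - 3 < x 0 - x 1 ∨ x 0 - x 1 < -(L - 3)))))
    (hy : (y 0 + y 1 ≤ L ∧ -L ≤ y 0 + y 1 ∧ y 0 - y 1 ≤ L ∧ -L ≤ y 0 - y 1) ∧
      (L - 1 ≤ y 0 - y 1 ∨ y 0 - y 1 ≤ -(L - 1) ∨ y 0 + y 1 ≤ -(L - 1) ∨
        (L - 1 ≤ y 0 + y 1 ∧ (L - 3 < y 0 - y 1 ∨ y 0 - y 1 < -(L - 3))))) :
    s(x, y) ∈ (anchorData δ).bcBondConfig ω := by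
  refine DiscreteDobrushin.mem_bcBondConfig_of_arcA
    ((SimpleGraph.mem_edgeSet _).2 ((AnchorLattice.adj_iff hδ hLδ hL1).2 ⟨hxy, ?_, ?_⟩)) fun z hz => ?_
  · rw [abs_le, abs_le]; omega
  · rw [abs_le, abs_le]; omega
  · rcases Sym2.mem_iff.1 hz with rfl | rfl
    · exact memA_of hδ hLδ hL1 hL hx
    · exact memA_of hδ hLδ hL1 hL hy

/-- The target edge of a corner `(v, k)` between two sites of the wired arc is open in every completed
configuration. [cite: Smirnov2001, §2] -/
theorem openA_tgt {v : Site 2} {k : Fin 4} (ω : BondConfig (Site 2))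
    (hx : (v 0 + v 1 ≤ L ∧ -L ≤ v 0 + v 1 ∧ v 0 - v 1 ≤ L ∧ -L ≤ v 0 - v 1) ∧
      (L - 1 ≤ v 0 - v 1 ∨ v 0 - v 1 ≤ -(L - 1) ∨ v 0 + v 1 ≤ -(L - 1) ∨
        (L - 1 ≤ v 0 + v 1 ∧ (L - 3 < v 0 - v 1 ∨ v 0 - v 1 < -(L - 3)))))
    (hy : ((v + cornerUnit (k + 1)) 0 + (v + cornerUnit (k + 1)) 1 ≤ L ∧
        -L ≤ (v + cornerUnit (k + 1)) 0 + (v + cornerUnit (k + 1)) 1 ∧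
        (v + cornerUnit (k + 1)) 0 - (v + cornerUnit (k + 1)) 1 ≤ L ∧
        -L ≤ (v + cornerUnit (k + 1)) 0 - (v + cornerUnit (k + 1)) 1) ∧
      (L - 1 ≤ (v + cornerUnit (k + 1)) 0 - (v + cornerUnit (k + 1)) 1 ∨
        (v + cornerUnit (k + 1)) 0 - (v + cornerUnit (k + 1)) 1 ≤ -(L - 1) ∨
        (v + cornerUnit (k + 1)) 0 + (v + cornerUnit (k + 1)) 1 ≤ -(L - 1) ∨
        (L - 1 ≤ (v + cornerUnit (k + 1)) 0 + (v + cornerUnit (k + 1)) 1 ∧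
          (L - 3 < (v + cornerUnit (k + 1)) 0 - (v + cornerUnit (k + 1)) 1 ∨
            (v + cornerUnit (k + 1)) 0 - (v + cornerUnit (k + 1)) 1 < -(L - 3))))) :
    cTgt (v, k) ∈ (anchorData δ).bcBondConfig ω :=
  openA_of hδ hLδ hL1 hL (zdGraph_adj_add_cornerUnit v (k + 1)) ω hx hy

/-- **The layer edges are closed in the completed all-closed configuration**: an edge with an endpoint
below the boundary layer (off the arc `A`) is not open in `E.bcBondConfig ∅`. [cite: Smirnov2001, §2] -/
theorem closed_empty_of {x y : Site 2}
    (hy : y 0 + y 1 < L - 1 ∧ -(L - 1) < y 0 + y 1 ∧ y 0 - y 1 < L - 1 ∧ -(L - 1) < y 0 - y 1) :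
    s(x, y) ∉ (anchorData δ).bcBondConfig ∅ := by
  rintro ⟨-, hA | ⟨hω, -⟩⟩
  · exact AnchorFree.notA_of hδ hLδ hL1 hL hy (hA y (Sym2.mem_mk_right _ _))
  · exact hω

/-- The target edge of a corner `(v, k)` with `v + u_{k+1}` below the boundary layer is closed in the
completed all-closed configuration. [cite: Smirnov2001, §2] -/
theorem closed_empty_tgt {v : Site 2} {k : Fin 4}
    (hy : (v + cornerUnit (k + 1)) 0 + (v + cornerUnit (k + 1)) 1 < L - 1 ∧
      -(L - 1) < (v + cornerUnit (k + 1)) 0 + (v + cornerUnit (k + 1)) 1 ∧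
      (v + cornerUnit (k + 1)) 0 - (v + cornerUnit (k + 1)) 1 < L - 1 ∧
      -(L - 1) < (v + cornerUnit (k + 1)) 0 - (v + cornerUnit (k + 1)) 1) :
    cTgt (v, k) ∉ (anchorData δ).bcBondConfig ∅ :=
  closed_empty_of hδ hLδ hL1 hL hy

end Level

end AnchorWired

/-! ## The lower-right wired side -/

namespace AnchorWiredLR

variable {δ : ℝ} {L : ℤ}

section Level

variable (hδ : 0 < δ) (hLδ : (L : ℝ) * δ < 2) (hL1 : 2 ≤ ((L : ℝ) + 1) * δ) (hL : 4 ≤ L)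
  (hE : (anchorData δ).IsZdAdmissible)
include hδ hLδ hL1 hL

/-! ### The swing around a boundary face, in every configuration -/

/-- **The swing, forward.** If the exploration is at the entering dart `(F + e₀ + e₁, 2)` of a face `F`
of the lower-right wired side (`d(F) = L - 1`, `-L ≤ s(F) ≤ L - 2`) at time `n < T`, it follows the two
frozen-open sides `s(F + e₀ + e₁, F + e₀)`, `s(F + e₀, F)` of `F`: `orb (n + 1) = (F + e₀, 1)`,
`orb (n + 2) = (F, 0)`, `n + 2 < T`, turn counts `t - 1`, `t - 2`. [cite: Smirnov2001, §2] -/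
theorem swing_fwd {F : Site 2} (hd : F 0 - F 1 = L - 1) (hs : F 0 + F 1 ≤ L - 2) (hs' : -L ≤ F 0 + F 1)
    {ω : BondConfig (Site 2)} {n : ℕ} (hn : n < exitTime hE ω)
    (h : cornerOrbit ((anchorData δ).bcBondConfig ω) (startCorner hE) n = (F + cornerUnit 0 + cornerUnit 1, 2)) :
    n + 2 < exitTime hE ω ∧
      cornerOrbit ((anchorData δ).bcBondConfig ω) (startCorner hE) (n + 1) = (F + cornerUnit 0, 1) ∧
      cornerOrbit ((anchorData δ).bcBondConfig ω) (startCorner hE) (n + 2) = (F, 0) ∧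
      turnCount ((anchorData δ).bcBondConfig ω) (startCorner hE) (n + 1) =
        turnCount ((anchorData δ).bcBondConfig ω) (startCorner hE) n - 1 ∧
      turnCount ((anchorData δ).bcBondConfig ω) (startCorner hE) (n + 2) =
        turnCount ((anchorData δ).bcBondConfig ω) (startCorner hE) n - 2 := by
  -- follow `s(F + e₀ + e₁, F + e₀)`
  obtain ⟨hT1, h1, htc1⟩ := AnchorFree.step_open hE (v' := F + cornerUnit 0) (k' := 1) hn h
    (AnchorWired.openA_tgt hδ hLδ hL1 hL _ (by simp; omega) (by simp; omega))
    (by ext i; fin_cases i <;> simp) rfl (AnchorFree.face_of hδ hLδ hL1 (by simp [cFace, faceAt]; omega))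
  -- follow `s(F + e₀, F)`
  obtain ⟨hT2, h2, htc2⟩ := AnchorFree.step_open hE (v' := F) (k' := 0) hT1 h1
    (AnchorWired.openA_tgt hδ hLδ hL1 hL _ (by simp; omega) (by simp; omega))
    (by ext i; fin_cases i <;> simp) rfl (AnchorFree.face_of hδ hLδ hL1 (by simp [cFace, faceAt]; omega))
  exact ⟨hT2, h1, h2, htc1, by rw [htc2, htc1]; ring⟩

/-- **The swing, backward.** A visit `orb n = (F, 0)` of the leaving dart of such a face is preceded by the
two other darts of the swing: `n = n' + 2`, `orb n' = (F + e₀ + e₁, 2)`, `orb (n' + 1) = (F + e₀, 1)` (the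
source edges `s(F, F + e₀)`, `s(F + e₀, F + e₀ + e₁)` are frozen open, so the predecessors are the
follow-predecessors, `WiredTouch.orbit_pred_of_mem`; neither dart is the start corner `((L-1,1), 2)`).
[cite: Smirnov2001, §2] -/
theorem swing_bwd {F : Site 2} (hd : F 0 - F 1 = L - 1) (hs : F 0 + F 1 ≤ L - 2) (hs' : -L ≤ F 0 + F 1)
    {ω : BondConfig (Site 2)} {n : ℕ}
    (h : cornerOrbit ((anchorData δ).bcBondConfig ω) (startCorner hE) n = (F, 0)) :
    ∃ n', n = n' + 2 ∧
      cornerOrbit ((anchorData δ).bcBondConfig ω) (startCorner hE) n' = (F + cornerUnit 0 + cornerUnit 1, 2) ∧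
      cornerOrbit ((anchorData δ).bcBondConfig ω) (startCorner hE) (n' + 1) = (F + cornerUnit 0, 1) := by
  have hst := AnchorFree.startCorner_eq hδ hLδ hL1 hL hE
  obtain ⟨j, rfl, hj⟩ := WiredTouch.orbit_pred_of_mem hE (v := F) (k := 0) (by rw [hst]; simp)
    (AnchorWired.openA_of hδ hLδ hL1 hL (zdGraph_adj_add_cornerUnit F 0) ω (by omega) (by simp; omega)) h
  have hj1 : cornerOrbit ((anchorData δ).bcBondConfig ω) (startCorner hE) j = (F + cornerUnit 0, 1) := hj
  obtain ⟨j', rfl, hj'⟩ := WiredTouch.orbit_pred_of_mem hE (v := F + cornerUnit 0) (k := 1) (by rw [hst]; simp)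
    (AnchorWired.openA_of hδ hLδ hL1 hL (zdGraph_adj_add_cornerUnit _ 1) ω (by simp; omega) (by simp; omega)) hj1
  exact ⟨j', rfl, hj', hj1⟩

/-! ### Absolute anchoring: the all-closed exploration hugs the wired arc -/

/-- **Four explicit steps of the all-closed exploration**:
`((L-1,1),2) → ((L-1,0),1) → ((L-1,0),2) → ((L-1,-1),1) → ((L-2,-1),0)` (follow `s((L-1,1),(L-1,0))`, cross
the layer edge `s((L-1,0),(L-2,0))`, follow `s((L-1,0),(L-1,-1))`, follow `s((L-1,-1),(L-2,-1))`), all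
before the exit; turn counts `0, -1, 0, -1, -2`. [cite: Smirnov2001, §2] -/
theorem orbit_four : 4 < exitTime hE ∅ ∧
    cornerOrbit ((anchorData δ).bcBondConfig ∅) (startCorner hE) 4 = ((![L - 2, -1] : Site 2), 0) ∧
      turnCount ((anchorData δ).bcBondConfig ∅) (startCorner hE) 4 = -2 := by
  have h0 : cornerOrbit ((anchorData δ).bcBondConfig ∅) (startCorner hE) 0 = ((![L - 1, 1] : Site 2), 2) := by
    rw [cornerOrbit_zero, AnchorFree.startCorner_eq hδ hLδ hL1 hL hE]
  have hT0 : 0 < exitTime hE ∅ := DiscreteDobrushin.exitTime_pos hE _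
  -- step 1: follow `s((L-1,1),(L-1,0))`
  obtain ⟨hT1, h1, htc1⟩ := AnchorFree.step_open hE (v' := ![L - 1, 0]) (k' := 1) hT0 h0
    (AnchorWired.openA_tgt hδ hLδ hL1 hL _ (by simp; omega) (by simp; omega)) (by ext i; fin_cases i <;> simp)
    rfl (AnchorFree.face_of hδ hLδ hL1 (by simp [cFace, faceAt]; omega))
  -- step 2: cross the layer edge `s((L-1,0),(L-2,0))`
  obtain ⟨hT2, h2, htc2⟩ := AnchorFree.step_closed hE (k' := 2) hT1 h1
    (AnchorWired.closed_empty_tgt hδ hLδ hL1 hL (by simp; omega)) rfl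
    (AnchorFree.face_of hδ hLδ hL1 (by simp [cFace, faceAt]; omega))
  -- step 3: follow `s((L-1,0),(L-1,-1))`
  obtain ⟨hT3, h3, htc3⟩ := AnchorFree.step_open hE (v' := ![L - 1, -1]) (k' := 1) hT2 h2
    (AnchorWired.openA_tgt hδ hLδ hL1 hL _ (by simp; omega) (by simp; omega)) (by ext i; fin_cases i <;> simp)
    rfl (AnchorFree.face_of hδ hLδ hL1 (by simp [cFace, faceAt]; omega))
  -- step 4: follow `s((L-1,-1),(L-2,-1))`
  obtain ⟨hT4, h4, htc4⟩ := AnchorFree.step_open hE (v' := ![L - 2, -1]) (k' := 0) hT3 h3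
    (AnchorWired.openA_tgt hδ hLδ hL1 hL _ (by simp; omega) (by simp; omega))
    (by ext i; fin_cases i <;> simp; omega) rfl (AnchorFree.face_of hδ hLδ hL1 (by simp [cFace, faceAt]; omega))
  refine ⟨hT4, h4, ?_⟩
  rw [htc4, htc3, htc2, htc1, turnCount_zero]; norm_num

/-- **One face down the side, in the all-closed exploration.** From a visit `orb n = (F, 0)` (`n < T`,
`d(F) = L - 1`, `|s(F)| ≤ L - 3`) four steps lead to `(F - e₀ - e₁, 0)` with the same turn count: cross the
layer edges `s(F, F + e₁)`, `s(F, F - e₀)`, follow the frozen-open `s(F, F - e₁)`, `s(F - e₁, F - e₀ - e₁)`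
(turns `+1, +1, -1, -1`). [cite: Smirnov2001, §2] -/
theorem shift_empty {F : Site 2} (hd : F 0 - F 1 = L - 1) (hs : F 0 + F 1 ≤ L - 3) (hs' : -(L - 3) ≤ F 0 + F 1)
    {n : ℕ} (hn : n < exitTime hE ∅) (h : cornerOrbit ((anchorData δ).bcBondConfig ∅) (startCorner hE) n = (F, 0)) :
    n + 4 < exitTime hE ∅ ∧
      cornerOrbit ((anchorData δ).bcBondConfig ∅) (startCorner hE) (n + 4) = (F - cornerUnit 0 - cornerUnit 1, 0) ∧
      turnCount ((anchorData δ).bcBondConfig ∅) (startCorner hE) (n + 4) =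
        turnCount ((anchorData δ).bcBondConfig ∅) (startCorner hE) n := by
  -- step 1: cross the layer edge `s(F, F + e₁)`
  obtain ⟨hT1, h1, htc1⟩ := AnchorFree.step_closed hE (k' := 1) hn h
    (AnchorWired.closed_empty_tgt hδ hLδ hL1 hL (by simp; omega)) rfl
    (AnchorFree.face_of hδ hLδ hL1 (by simp [cFace, faceAt]; omega))
  -- step 2: cross the layer edge `s(F, F - e₀)`
  obtain ⟨hT2, h2, htc2⟩ := AnchorFree.step_closed hE (k' := 2) hT1 h1
    (AnchorWired.closed_empty_tgt hδ hLδ hL1 hL (by simp; omega)) rfl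
    (AnchorFree.face_of hδ hLδ hL1 (by simp [cFace, faceAt]; omega))
  -- step 3: follow `s(F, F - e₁)`
  obtain ⟨hT3, h3, htc3⟩ := AnchorFree.step_open hE (v' := F - cornerUnit 1) (k' := 1) hT2 h2
    (AnchorWired.openA_tgt hδ hLδ hL1 hL _ (by omega) (by simp; omega))
    (by ext i; fin_cases i <;> simp [sub_eq_add_neg]) rfl
    (AnchorFree.face_of hδ hLδ hL1 (by simp [cFace, faceAt]; omega))
  -- step 4: follow `s(F - e₁, F - e₀ - e₁)`
  obtain ⟨hT4, h4, htc4⟩ := AnchorFree.step_open hE (v' := F - cornerUnit 0 - cornerUnit 1) (k' := 0) hT3 h3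
    (AnchorWired.openA_tgt hδ hLδ hL1 hL _ (by simp; omega) (by simp; omega))
    (by ext i; fin_cases i <;> simp [sub_eq_add_neg]) rfl
    (AnchorFree.face_of hδ hLδ hL1 (by simp [cFace, faceAt]; omega))
  refine ⟨hT4, h4, ?_⟩
  rw [htc4, htc3, htc2, htc1]; ring

/-- **Every leaving dart `(F, 0)` of the lower-right wired side is visited by the all-closed exploration,
with turn count `-2`.** By induction on `m`, for the face `F` with `d(F) = L - 1` and
`s(F) = L - 3 - 2m ≥ -(L - 1)`: for `m = 0` this is `orbit_four`; the step is `shift_empty` at the previous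
face `F + e₀ + e₁`. [cite: Smirnov2010, proof of Lemma 4.5] -/
theorem visit_all (m : ℕ) : ∀ F : Site 2, F 0 - F 1 = L - 1 → F 0 + F 1 + 2 * m = L - 3 → -(L - 1) ≤ F 0 + F 1 →
    ∃ n < exitTime hE ∅, cornerOrbit ((anchorData δ).bcBondConfig ∅) (startCorner hE) n = (F, 0) ∧
      turnCount ((anchorData δ).bcBondConfig ∅) (startCorner hE) n = -2 := by
  induction m with
  | zero =>
    intro F hd hs _
    push_cast at hs
    obtain ⟨h4, horb, htc⟩ := orbit_four hδ hLδ hL1 hL hE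
    obtain rfl : F = ![L - 2, -1] := Site.eq_iff_two.2 ⟨by simp; omega, by simp; omega⟩
    exact ⟨4, h4, horb, htc⟩
  | succ m ih =>
    intro F hd hs hs'
    push_cast at hs
    obtain ⟨n, hn, h, htc⟩ := ih (F + cornerUnit 0 + cornerUnit 1) (by simp; omega) (by simp; omega)
      (by simp; omega)
    obtain ⟨hn4, h4, htc4⟩ := shift_empty hδ hLδ hL1 hL hE (F := F + cornerUnit 0 + cornerUnit 1)
      (by simp; omega) (by simp; omega) (by simp; omega) hn h
    have hF : F + cornerUnit 0 + cornerUnit 1 - cornerUnit 0 - cornerUnit 1 = F := by abel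
    rw [hF] at h4
    exact ⟨n + 4, hn4, h4, htc4.trans htc⟩

/-! ### The two corner observables at a face of the side -/

include hE in
/-- **The absolute wired phases of the lower-right side at level `L`.** For every face `F` with
`d(F) = L - 1`, `|s(F)| ≤ L - 5` of the anchor data: `G(F + e₀ + e₁, F) = sixthPhase 0 · P` and
`G(F, F) = sixthPhase (-2) · P`, `P` the probability that the exploration visits the leaving dart `(F, 0)`
(= swings around `F`). The all-closed visit of `(F, 0)` has turn count `-2` (`visit_all`); the wired
TouchPhase (`WiredTouch.turnCount_visit_const`, hole-free inner faces by `holeFree_innerFaces`) transfers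
`-2` to every visit of `(F, 0)`, and the swing (`swing_fwd/bwd`) makes the entering dart visited exactly when
`(F, 0)` is, two steps earlier, with turn count `0`; `WiredTouch.cornerObs_eq_of_visit_iff` evaluates both.
[cite: DuminilCopin2012Parafermion, Proposition 5] -/
theorem wiredPhaseLR_of_level {F : Site 2} (hd : F 0 - F 1 = L - 1) (hs : |F 0 + F 1| ≤ L - 5) :
    cornerObs (anchorData δ) δ (F + cornerUnit 0 + cornerUnit 1) F = sixthPhase 0 *
        (((bondPercolation (zdGraph 2) half).real
          {ω : BondConfig (Site 2) | ∃ n < exitTime hE ω,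
            cornerOrbit ((anchorData δ).bcBondConfig ω) (startCorner hE) n = (F, 0)} : ℝ) : ℂ) ∧
      cornerObs (anchorData δ) δ F F = sixthPhase (-2) *
        (((bondPercolation (zdGraph 2) half).real
          {ω : BondConfig (Site 2) | ∃ n < exitTime hE ω,
            cornerOrbit ((anchorData δ).bcBondConfig ω) (startCorner hE) n = (F, 0)} : ℝ) : ℂ) := by
  rw [abs_le] at hs
  have hH : HoleFree {f : Site 2 | (anchorData δ).IsInnerFace f} :=
    holeFree_innerFaces anchorDomain.toJordanDomain rfl hδ
  -- the all-closed visit of `(F, 0)`, with turn count `-2`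
  obtain ⟨m, hm⟩ := Int.eq_ofNat_of_zero_le (show (0 : ℤ) ≤ -1 - F 1 by omega)
  obtain ⟨n₀, hn₀, h₀, htc₀⟩ := visit_all hδ hLδ hL1 hL hE m F hd (by omega) (by omega)
  have hA : F ∈ (anchorData δ).zdArcA := AnchorWired.memA_of hδ hLδ hL1 hL (by omega)
  -- wired TouchPhase: every visit of `(F, 0)` has turn count `-2`
  have hτ : ∀ (ω : BondConfig (Site 2)) (n : ℕ), n < exitTime hE ω →
      cornerOrbit ((anchorData δ).bcBondConfig ω) (startCorner hE) n = (F, 0) →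
      turnCount ((anchorData δ).bcBondConfig ω) (startCorner hE) n = -2 :=
    WiredTouch.turnCount_visit_const hE hH (c := (F, 0)) hA hn₀ h₀ htc₀
  obtain ⟨e2, -, e0⟩ := S5.cFace_corner_site F
  -- the entering dart is visited iff `(F, 0)` is, with turn count `0`
  have hiff : ∀ ω : BondConfig (Site 2),
      (∃ j < exitTime hE ω, cornerOrbit ((anchorData δ).bcBondConfig ω) (startCorner hE) j =
        (F + cornerUnit 0 + cornerUnit 1, 2)) ↔
      ∃ n < exitTime hE ω, cornerOrbit ((anchorData δ).bcBondConfig ω) (startCorner hE) n = (F, 0) := by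
    intro ω
    constructor
    · rintro ⟨j, hj, hjr⟩
      obtain ⟨hj2, -, h2, -, -⟩ := swing_fwd hδ hLδ hL1 hL hE hd (by omega) (by omega) hj hjr
      exact ⟨j + 2, hj2, h2⟩
    · rintro ⟨n, hn, hnr⟩
      obtain ⟨n', rfl, hn', -⟩ := swing_bwd hδ hLδ hL1 hL hE hd (by omega) (by omega) hnr
      exact ⟨n', by omega, hn'⟩
  have hτ' : ∀ (ω : BondConfig (Site 2)) (j : ℕ), j < exitTime hE ω →
      cornerOrbit ((anchorData δ).bcBondConfig ω) (startCorner hE) j = (F + cornerUnit 0 + cornerUnit 1, 2) →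
      turnCount ((anchorData δ).bcBondConfig ω) (startCorner hE) j = 0 := by
    intro ω j hj hjr
    obtain ⟨hj2, -, h2, -, htc2⟩ := swing_fwd hδ hLδ hL1 hL hE hd (by omega) (by omega) hj hjr
    have := hτ ω (j + 2) hj2 h2
    omega
  exact ⟨WiredTouch.cornerObs_eq_of_visit_iff hE (r := (F + cornerUnit 0 + cornerUnit 1, 2)) rfl e2 F 0 hiff hτ',
    WiredTouch.cornerObs_eq_of_visit_iff hE (r := (F, 0)) rfl e0 F (-2) (fun _ => Iff.rfl) hτ⟩

end Level

end AnchorWiredLR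

/-- **Registered sub-goal `stub_anchorWiredPhaseLR`** (of the stub `stub_anchorMoment_of_IP`, line
`strip-anchored-vertex-normalisation`, skeleton r4): for `0 < δ ≤ 1/8` there is a level `L`
(`L δ < 2 ≤ (L + 1) δ`) such that every face `F` of the lower-right wired side of the concrete anchor data
`anchorData δ` (`F₀ - F₁ = L - 1`, `|F₀ + F₁| ≤ L - 5`) has the ABSOLUTE corner phases
`G(F + e₀ + e₁, F) = sixthPhase 0 · P`, `G(F, F) = sixthPhase (-2) · P` with one `P ≥ 0` (the probability
that the exploration swings around `F`). [cite: DuminilCopin2012Parafermion, Proposition 5] -/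
theorem stub_anchorWiredPhaseLR : ∀ δ : ℝ, 0 < δ → δ ≤ 1 / 8 → ∃ L : ℤ, (L : ℝ) * δ < 2 ∧ 2 ≤ ((L : ℝ) + 1) * δ ∧ ∀ F : Site 2, F 0 - F 1 = L - 1 → |F 0 + F 1| ≤ L - 5 → ∃ P : ℝ, 0 ≤ P ∧ cornerObs (anchorData δ) δ (F + cornerUnit 0 + cornerUnit 1) F = sixthPhase 0 * (P : ℂ) ∧ cornerObs (anchorData δ) δ F F = sixthPhase (-2) * (P : ℂ) := by
  intro δ hδ hδ8
  obtain ⟨L, hL7, hLδ, hL1⟩ := AnchorLattice.exists_level hδ (hδ8.trans (by norm_num))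
  exact ⟨L, hLδ, hL1, fun F hd hs => ⟨_, measureReal_nonneg,
    AnchorWiredLR.wiredPhaseLR_of_level hδ hLδ hL1 (by omega) (AnchorLattice.isZdAdmissible hδ hLδ hL1 (by omega))
      hd hs⟩⟩

end Summit.CriticalPhenomena.CardyFormulaZ2.Theorems.ParafermionFamiliesToSLESix.StripAnchored

end
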